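import Literature.MathematicalPhysics.KineticTheory.KickMatchedSwapRestart
import Literature.Analysis.FluidPDE.HardSphereCollisionEnumeration
import HarnessLib

/-!
# Bookkeeping of the collisions of a hard-sphere orbit for the kick swap

Topic `Literature/MathematicalPhysics/KineticTheory`. Node B0 of the lemma DAG of stub S3a `SwapIdentity` of the crux line
`stein-lindeberg-kick-swap` (`InformationPercolationEngine.PercolationClosesChaos`, stmt-AtomisticToContinuum-13914):
the swap vocabulary of `KickMatchedHardSphereGas` — `collTime σ N Φ z k` (the `k`-th collision time after `0` of the
orbit of `z`), `numColl` (number of collisions in `(0, τ]`), `postAt`, `pairAt`, `preAt`, `trueKick` — is what its names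
say on the good set of the deterministic flow `Φ`:

* ENUMERATION (for any set of reals finite on bounded intervals, then for orbits): the `k`-th enumerated time for
  `k < #(S ∩ (a, τ])` is an element of `S ∩ (a, τ]` (`nthTimeAfter_mem_Ioc_of_lt_ncard`, `collTime_mem`), the
  enumeration is strictly increasing below the count (`strictMonoOn_nthTimeAfter_Iio_ncard`,
  `collTime_strictMonoOn`), exhaustive (`exists_nthTimeAfter_eq_of_mem_Ioc`, `exists_collTime_eq`), and there is no
  element between consecutive enumerated times, before the first, or after the last one up to `τ`
  (`not_mem_collisionTimes_of_mem_Ioo_collTime(_zero)`, `not_mem_of_nthTimeAfter_lt`,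
  `not_mem_collisionTimes_of_collTime_lt`, `not_mem_collisionTimes_of_numColl_eq_zero`);
* STRUCTURE AT A COLLISION: `pairAt` is the increasing contact pair of `postAt` (`pairAt_mem_contactPairs`), `postAt`
  and `preAt` are in contact for it, `preAt` is the left limit of the orbit and is incoming, indeed a simple incoming
  collision configuration (`preAt_eq_leftLim`, `isIncoming_preAt`, `isSimpleIncomingWith_preAt`), so the true kick is
  admissible and kicking `preAt` with it is the elastic collision (`isAdmissible_trueKick`, from the landed
  `kickAt_trueKick_preAt`);
* NEXT-COLLISION DATA for the restart of `Z*` from a post-collisional configuration: the exit time of `postAt z k` is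
  `collTime (k+1) − collTime k`, its exit configuration is `preAt z (k+1)` (`freeExitTime_postAt`,
  `freeFlight_postAt`), and from the datum `z` itself the first exit is at `collTime 0` onto `preAt z 0`
  (`freeExitTime_self`, `freeFlight_self`); in between the orbit is the free flight (`flow_eq_freeFlight_postAt`).

All statements are for `z ∈ Φ.good`; the regular-geometry ones assume `hsDiameter σ N < 1/2`.

References: I. Gallagher, L. Saint-Raymond, B. Texier, *From Newton to Boltzmann* (2013), §4.1, Def. 4.1.2,
Prop. 4.1.1 (the ordered list of collision times of a good trajectory) [GST2013]; C. Cercignani, R. Illner,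
M. Pulvirenti, *The Mathematical Theory of Dilute Gases* (1994), App. 4.A (the collision recursion) [CIP1994].
-/

noncomputable section

open scoped BigOperators ENNReal Topology RealInnerProductSpace
open MeasureTheory Set Filter Function
open Literature.Analysis.FluidPDE

namespace Literature.MathematicalPhysics.KineticTheory.KickMatchedHardSphereGas

/-! ## Enumeration of a locally finite set of times in a window `(a, τ]` -/

section Enumeration

variable {S : Set ℝ}

/-- **The enumeration of a nonempty window is the increasing bijection onto it.** If `S` (finite on bounded
intervals) meets `(a, τ]` in `m + 1` points, then `n ↦ nthTimeAfter S a n`, `n ≤ m`, lists `S ∩ (a, τ]` in increasing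
order, exhaustively (apply `nthTimeAfter_enum` at the largest element of the window). [folklore] -/
theorem nthTimeAfter_enum_ncard (hfin : ∀ a b, (S ∩ Ioc a b).Finite) {a τ : ℝ} (hne : (S ∩ Ioc a τ).Nonempty) :
    ∃ m, (S ∩ Ioc a τ).ncard = m + 1 ∧ (∀ n ≤ m, nthTimeAfter S a n ∈ S ∩ Ioc a τ) ∧
      StrictMonoOn (nthTimeAfter S a) (Iic m) ∧ ∀ u ∈ S ∩ Ioc a τ, ∃ n ≤ m, nthTimeAfter S a n = u := by
  set F := (hfin a τ).toFinset with hF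
  have hFne : F.Nonempty := by
    obtain ⟨u, hu⟩ := hne
    exact ⟨u, (Set.Finite.mem_toFinset _).2 hu⟩
  have hsmax : F.max' hFne ∈ S ∩ Ioc a τ := (Set.Finite.mem_toFinset _).1 (F.max'_mem hFne)
  have hle : ∀ u ∈ S ∩ Ioc a τ, u ≤ F.max' hFne := fun u hu => F.le_max' u ((Set.Finite.mem_toFinset _).2 hu)
  have heq : S ∩ Ioc a (F.max' hFne) = S ∩ Ioc a τ := by
    ext u
    constructor
    · rintro ⟨hu, hau, hus⟩
      exact ⟨hu, hau, hus.trans hsmax.2.2⟩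
    · rintro ⟨hu, hau, huτ⟩
      exact ⟨hu, hau, hle u ⟨hu, hau, huτ⟩⟩
  obtain ⟨m, -, hmem, hmono, honto⟩ := nthTimeAfter_enum hfin hsmax.1 hsmax.2.1
  rw [heq] at hmem honto
  refine ⟨m, ?_, hmem, hmono, honto⟩
  have himg : nthTimeAfter S a '' Iic m = S ∩ Ioc a τ := by
    refine Set.Subset.antisymm ?_ fun u hu => ?_
    · rintro _ ⟨n, hn, rfl⟩
      exact hmem n hn
    · obtain ⟨n, hn, hnu⟩ := honto u hu
      exact ⟨n, hn, hnu⟩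
  have hIic : (Set.Iic m).ncard = m + 1 := by
    rw [← Finset.card_range (m + 1), ← Set.ncard_coe_finset]
    congr 1
    ext j
    simp
  rw [← himg, hmono.injOn.ncard_image, hIic]

/-- **Genuine enumerated times below the count**: if `S` (finite on bounded intervals) has more than `k` elements
in `(a, τ]`, its `k`-th enumerated time after `a` is an element of `S` in `(a, τ]`. [folklore] -/
theorem nthTimeAfter_mem_Ioc_of_lt_ncard (hfin : ∀ a b, (S ∩ Ioc a b).Finite) {a τ : ℝ} {k : ℕ}
    (hk : k < (S ∩ Ioc a τ).ncard) : nthTimeAfter S a k ∈ S ∩ Ioc a τ := by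
  have hne : (S ∩ Ioc a τ).Nonempty := Set.nonempty_of_ncard_ne_zero (by omega)
  obtain ⟨m, hM, hmem, -, -⟩ := nthTimeAfter_enum_ncard hfin hne
  exact hmem k (by omega)

/-- **The enumeration is strictly increasing below the count.** [folklore] -/
theorem strictMonoOn_nthTimeAfter_Iio_ncard (hfin : ∀ a b, (S ∩ Ioc a b).Finite) {a τ : ℝ} :
    StrictMonoOn (nthTimeAfter S a) (Iio (S ∩ Ioc a τ).ncard) := by
  intro i hi j hj hij
  have hj' := mem_Iio.1 hj
  have hne : (S ∩ Ioc a τ).Nonempty := Set.nonempty_of_ncard_ne_zero (by omega)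
  obtain ⟨m, hM, -, hmono, -⟩ := nthTimeAfter_enum_ncard hfin hne
  rw [hM] at hi hj
  exact hmono (mem_Iic.2 (Nat.lt_succ_iff.1 (mem_Iio.1 hi))) (mem_Iic.2 (Nat.lt_succ_iff.1 (mem_Iio.1 hj))) hij

/-- **Exhaustion**: every element of `S ∩ (a, τ]` is the `k`-th enumerated time after `a` for some `k` below the
count. [folklore] -/
theorem exists_nthTimeAfter_eq_of_mem_Ioc (hfin : ∀ a b, (S ∩ Ioc a b).Finite) {a τ u : ℝ}
    (hu : u ∈ S ∩ Ioc a τ) : ∃ k < (S ∩ Ioc a τ).ncard, nthTimeAfter S a k = u := by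
  obtain ⟨m, hM, -, -, honto⟩ := nthTimeAfter_enum_ncard hfin ⟨u, hu⟩
  obtain ⟨n, hn, hnu⟩ := honto u hu
  exact ⟨n, by omega, hnu⟩

/-- **Nothing after the last enumerated time**: if `S` has exactly `M + 1` elements in `(a, τ]`, no element of `S`
lies in `(t_M, τ]`. [folklore] -/
theorem not_mem_of_nthTimeAfter_lt (hfin : ∀ a b, (S ∩ Ioc a b).Finite) {a τ u : ℝ} {M : ℕ}
    (hM : (S ∩ Ioc a τ).ncard = M + 1) (hu : nthTimeAfter S a M < u) (huτ : u ≤ τ) : u ∉ S := by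
  intro huS
  have hM' : M < (S ∩ Ioc a τ).ncard := by omega
  obtain ⟨-, haM, -⟩ := nthTimeAfter_mem_Ioc_of_lt_ncard hfin hM'
  obtain ⟨k, hk, hku⟩ := exists_nthTimeAfter_eq_of_mem_Ioc hfin ⟨huS, haM.trans hu, huτ⟩
  have hle : nthTimeAfter S a k ≤ nthTimeAfter S a M :=
    (strictMonoOn_nthTimeAfter_Iio_ncard hfin).monotoneOn (mem_Iio.2 hk) (mem_Iio.2 hM') (by omega)
  rw [hku] at hle
  exact (not_lt.2 hle) hu

/-- **Empty window**: if `S` has no element counted in `(a, τ]`, no element of `S` lies in `(a, τ]`. [folklore] -/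
theorem not_mem_of_ncard_eq_zero (hfin : ∀ a b, (S ∩ Ioc a b).Finite) {a τ u : ℝ}
    (h0 : (S ∩ Ioc a τ).ncard = 0) (hau : a < u) (huτ : u ≤ τ) : u ∉ S := by
  intro huS
  have he : S ∩ Ioc a τ = ∅ := (Set.ncard_eq_zero (hfin a τ)).1 h0
  have hmem : u ∈ S ∩ Ioc a τ := ⟨huS, hau, huτ⟩
  rw [he] at hmem
  simp at hmem

end Enumeration

/-! ## The collisions of a good orbit in `(0, τ]` -/

section Orbit

variable {σ : ℝ} {N : ℕ}

/-- On the good set the collision times of the orbit are finite on bounded windows. [folklore] -/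
theorem finite_collisionTimes_orbit (Φ : Flow σ N) {z : Cfg N} (hz : z ∈ Φ.good) (a b : ℝ) :
    (collisionTimes geo (hsDiameter σ N) (fun t => Φ.flow t z) ∩ Ioc a b).Finite :=
  (Φ.isTrajectory z hz).finite_collisionTimes_inter_of_subset_Icc Ioc_subset_Icc_self

/-- Unfolding: `collTime` is the enumeration from `0` of the collision times of the orbit. [folklore] -/
theorem collTime_eq (Φ : Flow σ N) (z : Cfg N) (k : ℕ) :
    collTime σ N Φ z k = nthTimeAfter (collisionTimes geo (hsDiameter σ N) fun t => Φ.flow t z) 0 k := rfl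

/-- Unfolding: `numColl` counts the collision times of the orbit in `(0, τ]`. [folklore] -/
theorem numColl_eq (Φ : Flow σ N) (τ : ℝ) (z : Cfg N) :
    numColl σ N Φ τ z = (collisionTimes geo (hsDiameter σ N) (fun t => Φ.flow t z) ∩ Ioc 0 τ).ncard := rfl

/-- **The first `numColl` collision times are genuine**: for `k < numColl`, `collTime z k` is a collision time of the
orbit in `(0, τ]`. [folklore] -/
theorem collTime_mem (Φ : Flow σ N) {z : Cfg N} (hz : z ∈ Φ.good) {τ : ℝ} {k : ℕ} (hk : k < numColl σ N Φ τ z) :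
    collTime σ N Φ z k ∈ collisionTimes geo (hsDiameter σ N) (fun t => Φ.flow t z) ∧
      0 < collTime σ N Φ z k ∧ collTime σ N Φ z k ≤ τ := by
  obtain ⟨h1, h2, h3⟩ := nthTimeAfter_mem_Ioc_of_lt_ncard (finite_collisionTimes_orbit Φ hz) hk
  exact ⟨h1, h2, h3⟩

/-- **The collision times increase strictly** below `numColl`. [folklore] -/
theorem collTime_strictMonoOn (Φ : Flow σ N) {z : Cfg N} (hz : z ∈ Φ.good) (τ : ℝ) :
    StrictMonoOn (collTime σ N Φ z) (Iio (numColl σ N Φ τ z)) :=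
  strictMonoOn_nthTimeAfter_Iio_ncard (finite_collisionTimes_orbit Φ hz)

/-- Consecutive collision times increase strictly. [folklore] -/
theorem collTime_lt_succ (Φ : Flow σ N) {z : Cfg N} (hz : z ∈ Φ.good) {τ : ℝ} {k : ℕ}
    (hk : k + 1 < numColl σ N Φ τ z) : collTime σ N Φ z k < collTime σ N Φ z (k + 1) :=
  collTime_strictMonoOn Φ hz τ (mem_Iio.2 ((Nat.lt_succ_self k).trans hk)) (mem_Iio.2 hk) (Nat.lt_succ_self k)

/-- **Every collision in `(0, τ]` is enumerated** below `numColl`. [folklore] -/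
theorem exists_collTime_eq (Φ : Flow σ N) {z : Cfg N} (hz : z ∈ Φ.good) {τ u : ℝ}
    (hu : u ∈ collisionTimes geo (hsDiameter σ N) fun t => Φ.flow t z) (h0 : 0 < u) (huτ : u ≤ τ) :
    ∃ k < numColl σ N Φ τ z, collTime σ N Φ z k = u :=
  exists_nthTimeAfter_eq_of_mem_Ioc (finite_collisionTimes_orbit Φ hz) ⟨hu, h0, huτ⟩

/-- No collision strictly between consecutive enumerated collision times. [folklore] -/
theorem not_mem_collisionTimes_of_mem_Ioo_collTime (Φ : Flow σ N) {z : Cfg N} (hz : z ∈ Φ.good) {k : ℕ} {u : ℝ}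
    (hu : u ∈ Ioo (collTime σ N Φ z k) (collTime σ N Φ z (k + 1))) :
    u ∉ collisionTimes geo (hsDiameter σ N) fun t => Φ.flow t z :=
  not_mem_of_mem_Ioo_nthTimeAfter_succ (finite_collisionTimes_orbit Φ hz) hu

/-- No collision strictly between `0` and the first enumerated collision time. [folklore] -/
theorem not_mem_collisionTimes_of_mem_Ioo_collTime_zero (Φ : Flow σ N) {z : Cfg N} (hz : z ∈ Φ.good) {u : ℝ}
    (hu : u ∈ Ioo 0 (collTime σ N Φ z 0)) : u ∉ collisionTimes geo (hsDiameter σ N) fun t => Φ.flow t z :=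
  not_mem_of_mem_Ioo_nthTimeAfter_zero (finite_collisionTimes_orbit Φ hz 0) hu

/-- **No collision after the last one up to `τ`**: if `numColl = M + 1`, the orbit has no collision in
`(collTime M, τ]`. [folklore] -/
theorem not_mem_collisionTimes_of_collTime_lt (Φ : Flow σ N) {z : Cfg N} (hz : z ∈ Φ.good) {τ u : ℝ} {M : ℕ}
    (hM : numColl σ N Φ τ z = M + 1) (hu : collTime σ N Φ z M < u) (huτ : u ≤ τ) :
    u ∉ collisionTimes geo (hsDiameter σ N) fun t => Φ.flow t z :=
  not_mem_of_nthTimeAfter_lt (finite_collisionTimes_orbit Φ hz) hM hu huτ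

/-- **No collision at all in `(0, τ]`** if `numColl = 0`. [folklore] -/
theorem not_mem_collisionTimes_of_numColl_eq_zero (Φ : Flow σ N) {z : Cfg N} (hz : z ∈ Φ.good) {τ u : ℝ}
    (h0 : numColl σ N Φ τ z = 0) (hu : 0 < u) (huτ : u ≤ τ) :
    u ∉ collisionTimes geo (hsDiameter σ N) fun t => Φ.flow t z :=
  not_mem_of_ncard_eq_zero (finite_collisionTimes_orbit Φ hz) h0 hu huτ

/-! ## The structure of the orbit at a collision -/

/-- The pre-collisional configuration has the positions of the post-collisional one. [folklore] -/
theorem preAt_apply_fst (Φ : Flow σ N) (z : Cfg N) (k : ℕ) (l : Fin (N + 1)) :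
    ((preAt σ N Φ z k) l).1 = ((postAt σ N Φ z k) l).1 := by
  unfold preAt
  exact collidePair_apply_fst _ _

/-- **The colliding pair**: at a genuine collision (`collTime z k` a collision time of the orbit), `pairAt z k` is an
ordered contact pair of `postAt z k` with `fst < snd` (binary collisions and symmetry of contact on the torus make the
`i < j` order of the colliding pair available; `hsDiameter σ N < 1/2`). [folklore] -/
theorem pairAt_mem_contactPairs (hε2 : hsDiameter σ N < 2⁻¹) (Φ : Flow σ N) (z : Cfg N) {k : ℕ}
    (hk : collTime σ N Φ z k ∈ collisionTimes geo (hsDiameter σ N) fun t => Φ.flow t z) :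
    pairAt σ N Φ z k ∈ contactPairs geo (hsDiameter σ N) (postAt σ N Φ z k) ∧
      (pairAt σ N Φ z k).1 < (pairAt σ N Φ z k).2 := by
  classical
  have hG := Torus.isHardSphereRegular_geometry (d := Fin 3) hε2
  obtain ⟨⟨p, q⟩, hpq⟩ := mem_collisionTimes_iff_contactPairs_nonempty.1 hk
  have hne : p ≠ q := (mem_contactPairs.1 hpq).1
  have hSne : ((contactPairs geo (hsDiameter σ N) (postAt σ N Φ z k)).filter fun e => e.1 < e.2).Nonempty := by
    rcases lt_or_gt_of_ne hne with hlt | hgt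
    · exact ⟨(p, q), Finset.mem_filter.2 ⟨hpq, hlt⟩⟩
    · exact ⟨(q, p), Finset.mem_filter.2 ⟨(swap_mem_contactPairs_iff hG).2 hpq, hgt⟩⟩
  have hdef : pairAt σ N Φ z k = hSne.choose := by
    unfold pairAt
    exact dif_pos hSne
  rw [hdef]
  exact ⟨(Finset.mem_filter.1 hSne.choose_spec).1, (Finset.mem_filter.1 hSne.choose_spec).2⟩

/-- The colliding pair consists of two distinct particles. [folklore] -/
theorem pairAt_fst_ne_snd (hε2 : hsDiameter σ N < 2⁻¹) (Φ : Flow σ N) (z : Cfg N) {k : ℕ}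
    (hk : collTime σ N Φ z k ∈ collisionTimes geo (hsDiameter σ N) fun t => Φ.flow t z) :
    (pairAt σ N Φ z k).1 ≠ (pairAt σ N Φ z k).2 :=
  (pairAt_mem_contactPairs hε2 Φ z hk).2.ne

/-- The post-collisional configuration is in contact for the colliding pair. [folklore] -/
theorem postAt_mem_contactSet (hε2 : hsDiameter σ N < 2⁻¹) (Φ : Flow σ N) (z : Cfg N) {k : ℕ}
    (hk : collTime σ N Φ z k ∈ collisionTimes geo (hsDiameter σ N) fun t => Φ.flow t z) :
    postAt σ N Φ z k ∈ contactSet geo (N + 1) (hsDiameter σ N) (pairAt σ N Φ z k).1 (pairAt σ N Φ z k).2 :=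
  (mem_contactPairs.1 (pairAt_mem_contactPairs hε2 Φ z hk).1).2

/-- The pre-collisional configuration is in contact for the colliding pair. [folklore] -/
theorem preAt_mem_contactSet (hε2 : hsDiameter σ N < 2⁻¹) (Φ : Flow σ N) (z : Cfg N) {k : ℕ}
    (hk : collTime σ N Φ z k ∈ collisionTimes geo (hsDiameter σ N) fun t => Φ.flow t z) :
    preAt σ N Φ z k ∈ contactSet geo (N + 1) (hsDiameter σ N) (pairAt σ N Φ z k).1 (pairAt σ N Φ z k).2 :=
  (mem_contactSet_congr_fst (preAt_apply_fst Φ z k)).2 (postAt_mem_contactSet hε2 Φ z hk)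

/-- **No grazing**: the pre-collisional configuration is incoming for the colliding pair. [folklore] -/
theorem isIncoming_preAt (hε2 : hsDiameter σ N < 2⁻¹) (Φ : Flow σ N) {z : Cfg N} (hz : z ∈ Φ.good) {k : ℕ}
    (hk : collTime σ N Φ z k ∈ collisionTimes geo (hsDiameter σ N) fun t => Φ.flow t z) :
    IsIncoming geo (preAt σ N Φ z k) (pairAt σ N Φ z k).1 (pairAt σ N Φ z k).2 :=
  (Φ.isTrajectory z hz).isIncoming_collidePair (t := collTime σ N Φ z k) (pairAt_fst_ne_snd hε2 Φ z hk)
    (postAt_mem_contactSet hε2 Φ z hk)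

/-- **The pre-collisional configuration is the left limit of the orbit** at the collision time. [folklore] -/
theorem preAt_eq_leftLim (hε2 : hsDiameter σ N < 2⁻¹) (Φ : Flow σ N) {z : Cfg N} (hz : z ∈ Φ.good) {k : ℕ}
    (hk : collTime σ N Φ z k ∈ collisionTimes geo (hsDiameter σ N) fun t => Φ.flow t z) :
    preAt σ N Φ z k = Function.leftLim (fun t => Φ.flow t z) (collTime σ N Φ z k) :=
  ((Φ.isTrajectory z hz).leftLim_eq_collidePair (t := collTime σ N Φ z k) (pairAt_fst_ne_snd hε2 Φ z hk)
    (postAt_mem_contactSet hε2 Φ z hk)).symm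

/-- **Binary collision**: the pre-collisional configuration is a simple incoming collision configuration with
colliding pair `pairAt` (the only pairs in contact are `pairAt` and its swap). [folklore] -/
theorem isSimpleIncomingWith_preAt (hε2 : hsDiameter σ N < 2⁻¹) (Φ : Flow σ N) {z : Cfg N} (hz : z ∈ Φ.good)
    {k : ℕ} (hk : collTime σ N Φ z k ∈ collisionTimes geo (hsDiameter σ N) fun t => Φ.flow t z) :
    Alexander.IsSimpleIncomingWith geo (hsDiameter σ N) (preAt σ N Φ z k) (pairAt σ N Φ z k) := by
  have hG := Torus.isHardSphereRegular_geometry (d := Fin 3) hε2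
  have hij := pairAt_fst_ne_snd hε2 Φ z hk
  have hc := postAt_mem_contactSet hε2 Φ z hk
  refine ⟨(pairAt_mem_contactPairs hε2 Φ z hk).2, isIncoming_preAt hε2 Φ hz hk, fun i' j' hij' => ?_⟩
  obtain ⟨huniq, -⟩ := (Φ.isTrajectory z hz).binary (collTime σ N Φ z k) _ _ hij hc
  rw [mem_contactSet_congr_fst (i := i') (j := j') (preAt_apply_fst Φ z k)]
  refine ⟨huniq i' j' hij', fun he => ?_⟩
  rcases Alexander.finsetPair_eq_iff.1 he with ⟨h1, h2⟩ | ⟨h1, h2⟩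
  · rw [h1, h2]; exact hc
  · rw [h1, h2]; exact hG.mem_contactSet_comm.1 hc

/-- **The true kick is admissible and kicking with it is the elastic collision**: at a genuine collision,
`IsAdmissible (trueKick z k) (preAt z k)` and `kickAt (pairAt z k) (trueKick z k) (preAt z k) = postAt z k`
(`0 < hsDiameter σ N < 1/2`). [folklore] -/
theorem isAdmissible_trueKick (hε : 0 < hsDiameter σ N) (hε2 : hsDiameter σ N < 2⁻¹) (Φ : Flow σ N) {z : Cfg N}
    (hz : z ∈ Φ.good) {k : ℕ} (hk : collTime σ N Φ z k ∈ collisionTimes geo (hsDiameter σ N) fun t => Φ.flow t z) :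
    IsAdmissible σ N (pairAt σ N Φ z k).1 (pairAt σ N Φ z k).2 (trueKick σ N Φ z k) (preAt σ N Φ z k) ∧
      kickAt σ N (pairAt σ N Φ z k).1 (pairAt σ N Φ z k).2 (trueKick σ N Φ z k) (preAt σ N Φ z k) =
        postAt σ N Φ z k :=
  kickAt_trueKick_preAt hε Φ z k (preAt_mem_contactSet hε2 Φ z hk) (isIncoming_preAt hε2 Φ hz hk)
    (pairAt_fst_ne_snd hε2 Φ z hk)

/-- The true kick is a unit vector (at a genuine collision). [folklore] -/
theorem norm_trueKick (hε : 0 < hsDiameter σ N) (hε2 : hsDiameter σ N < 2⁻¹) (Φ : Flow σ N) {z : Cfg N}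
    (hz : z ∈ Φ.good) {k : ℕ} (hk : collTime σ N Φ z k ∈ collisionTimes geo (hsDiameter σ N) fun t => Φ.flow t z) :
    ‖trueKick σ N Φ z k‖ = 1 :=
  (isAdmissible_trueKick hε hε2 Φ hz hk).1.1

/-! ## Next-collision data: exit times and exit configurations along the orbit -/

/-- **From one collision to the next**: if `collTime k < collTime (k+1)` are both collision times of the orbit, the
free flight from `postAt z k` exits the domain after `collTime (k+1) − collTime k`, onto the simple incoming
configuration `preAt z (k+1)`, and Alexander's collision step lands on `postAt z (k+1)` (`hsDiameter σ N < 1/2`).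
[folklore] -/
theorem freeExitTime_postAt (hε2 : hsDiameter σ N < 2⁻¹) (Φ : Flow σ N) {z : Cfg N} (hz : z ∈ Φ.good) {k : ℕ}
    (hk1 : collTime σ N Φ z (k + 1) ∈ collisionTimes geo (hsDiameter σ N) fun t => Φ.flow t z)
    (hlt : collTime σ N Φ z k < collTime σ N Φ z (k + 1)) :
    Alexander.freeExitTime geo (hsDiameter σ N) (postAt σ N Φ z k) =
        ENNReal.ofReal (collTime σ N Φ z (k + 1) - collTime σ N Φ z k) ∧
      freeFlight geo (collTime σ N Φ z (k + 1) - collTime σ N Φ z k) (postAt σ N Φ z k) = preAt σ N Φ z (k + 1) ∧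
      Alexander.collisionStep geo (hsDiameter σ N) (postAt σ N Φ z k) = postAt σ N Φ z (k + 1) := by
  have hG := Torus.isHardSphereRegular_geometry (d := Fin 3) hε2
  obtain ⟨hτ, hll, -, hstep⟩ := (Φ.isTrajectory z hz).next_collision hG hlt hk1
    fun u hu => not_mem_collisionTimes_of_mem_Ioo_collTime Φ hz hu
  refine ⟨hτ, ?_, hstep⟩
  rw [← preAt_eq_leftLim hε2 Φ hz hk1] at hll
  exact hll.symm

/-- **From the datum to the first collision**: if `collTime 0 > 0` is a collision time of the orbit, the free flight
from `z ∈ Φ.good` exits after `collTime 0` onto `preAt z 0`, and the collision step lands on `postAt z 0`. [folklore] -/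
theorem freeExitTime_self (hε2 : hsDiameter σ N < 2⁻¹) (Φ : Flow σ N) {z : Cfg N} (hz : z ∈ Φ.good)
    (h0 : collTime σ N Φ z 0 ∈ collisionTimes geo (hsDiameter σ N) fun t => Φ.flow t z)
    (hpos : 0 < collTime σ N Φ z 0) :
    Alexander.freeExitTime geo (hsDiameter σ N) z = ENNReal.ofReal (collTime σ N Φ z 0) ∧
      freeFlight geo (collTime σ N Φ z 0) z = preAt σ N Φ z 0 ∧
      Alexander.collisionStep geo (hsDiameter σ N) z = postAt σ N Φ z 0 := by
  have hG := Torus.isHardSphereRegular_geometry (d := Fin 3) hε2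
  obtain ⟨hτ, hll, -, hstep⟩ := (Φ.isTrajectory z hz).next_collision hG (s := 0) hpos h0
    fun u hu => not_mem_collisionTimes_of_mem_Ioo_collTime_zero Φ hz hu
  simp only [sub_zero, Φ.flow_zero z hz] at hτ hll hstep
  refine ⟨hτ, ?_, hstep⟩
  rw [← hll, preAt_eq_leftLim hε2 Φ hz h0]

/-- **Free flight between collisions**: for `collTime k ≤ s` with no collision in `(collTime k, s]`... concretely for
`s < collTime (k+1)` (consecutive genuine collision times), `Φ_s z = S_{s − collTime k} (postAt z k)`. [folklore] -/
theorem flow_eq_freeFlight_postAt (Φ : Flow σ N) {z : Cfg N} (hz : z ∈ Φ.good) {k : ℕ} {s : ℝ}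
    (hks : collTime σ N Φ z k ≤ s) (hs : s < collTime σ N Φ z (k + 1)) :
    Φ.flow s z = freeFlight geo (s - collTime σ N Φ z k) (postAt σ N Φ z k) := by
  have h := (Φ.isTrajectory z hz).apply_add_eq_freeFlight (s := collTime σ N Φ z k) (u := s - collTime σ N Φ z k)
    (sub_nonneg.2 hks) fun u hu => not_mem_collisionTimes_of_mem_Ioo_collTime Φ hz ⟨hu.1, by linarith [hu.2]⟩
  rwa [add_sub_cancel] at h

/-- **Free flight before the first collision**: for `0 ≤ s < collTime 0`, `Φ_s z = S_s z`. [folklore] -/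
theorem flow_eq_freeFlight_self (Φ : Flow σ N) {z : Cfg N} (hz : z ∈ Φ.good) {s : ℝ} (h0s : 0 ≤ s)
    (hs : s < collTime σ N Φ z 0) : Φ.flow s z = freeFlight geo s z := by
  have h := (Φ.isTrajectory z hz).apply_add_eq_freeFlight (s := 0) (u := s) h0s
    fun u hu => not_mem_collisionTimes_of_mem_Ioo_collTime_zero Φ hz ⟨hu.1, by linarith [hu.2]⟩
  simpa only [zero_add, Φ.flow_zero z hz] using h

/-- **Free flight after the last collision up to `τ`**: if `numColl = M + 1` then for `collTime M ≤ s ≤ τ`,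
`Φ_s z = S_{s − collTime M} (postAt z M)`, and the exit time of `postAt z M` exceeds `τ − collTime M`. [folklore] -/
theorem flow_eq_freeFlight_postAt_last (hε2 : hsDiameter σ N < 2⁻¹) (Φ : Flow σ N) {z : Cfg N} (hz : z ∈ Φ.good)
    {τ : ℝ} {M : ℕ} (hM : numColl σ N Φ τ z = M + 1) {s : ℝ} (hMs : collTime σ N Φ z M ≤ s) (hsτ : s ≤ τ) :
    Φ.flow s z = freeFlight geo (s - collTime σ N Φ z M) (postAt σ N Φ z M) ∧
      ENNReal.ofReal (τ - collTime σ N Φ z M) < Alexander.freeExitTime geo (hsDiameter σ N) (postAt σ N Φ z M) := by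
  have hG := Torus.isHardSphereRegular_geometry (d := Fin 3) hε2
  have h := Φ.isTrajectory z hz
  have hfree : ∀ u ∈ Ioc (collTime σ N Φ z M) τ, u ∉ collisionTimes geo (hsDiameter σ N) fun t => Φ.flow t z :=
    fun u hu => not_mem_collisionTimes_of_collTime_lt Φ hz hM hu.1 hu.2
  refine ⟨?_, ?_⟩
  · have h1 := h.apply_add_eq_freeFlight (s := collTime σ N Φ z M) (u := s - collTime σ N Φ z M) (sub_nonneg.2 hMs)
      fun u hu => hfree u ⟨hu.1, by linarith [hu.2]⟩
    rwa [add_sub_cancel] at h1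
  · show ENNReal.ofReal (τ - collTime σ N Φ z M) <
      Alexander.freeExitTime geo (hsDiameter σ N) (Φ.flow (collTime σ N Φ z M) z)
    rcases h.exists_next_collision (collTime σ N Φ z M) with hnone | ⟨T, hMT, hT, hfree'⟩
    · rw [h.freeExitTime_apply_eq_top hnone]
      exact ENNReal.ofReal_lt_top
    · rw [(h.next_collision hG hMT hT hfree').1, ENNReal.ofReal_lt_ofReal_iff (sub_pos.2 hMT)]
      have hτT : τ < T := lt_of_not_ge fun hTτ => hfree T ⟨hMT, hTτ⟩ hT
      linarith

/-- **No collision up to `τ`**: if `numColl = 0` then for `0 ≤ s ≤ τ`, `Φ_s z = S_s z`, and the exit time of `z`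
exceeds `τ`. [folklore] -/
theorem flow_eq_freeFlight_self_of_numColl_eq_zero (hε2 : hsDiameter σ N < 2⁻¹) (Φ : Flow σ N) {z : Cfg N}
    (hz : z ∈ Φ.good) {τ : ℝ} (h0 : numColl σ N Φ τ z = 0) {s : ℝ} (h0s : 0 ≤ s) (hsτ : s ≤ τ) :
    Φ.flow s z = freeFlight geo s z ∧ ENNReal.ofReal τ < Alexander.freeExitTime geo (hsDiameter σ N) z := by
  have hG := Torus.isHardSphereRegular_geometry (d := Fin 3) hε2
  have h := Φ.isTrajectory z hz
  have hfree : ∀ u ∈ Ioc (0 : ℝ) τ, u ∉ collisionTimes geo (hsDiameter σ N) fun t => Φ.flow t z :=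
    fun u hu => not_mem_collisionTimes_of_numColl_eq_zero Φ hz h0 hu.1 hu.2
  refine ⟨?_, ?_⟩
  · have h1 := h.apply_add_eq_freeFlight (s := 0) (u := s) h0s fun u hu => hfree u ⟨hu.1, by linarith [hu.2]⟩
    simpa only [zero_add, Φ.flow_zero z hz] using h1
  · rcases h.exists_next_collision 0 with hnone | ⟨T, h0T, hT, hfree'⟩
    · have htop := h.freeExitTime_apply_eq_top hnone
      rw [Φ.flow_zero z hz] at htop
      rw [htop]
      exact ENNReal.ofReal_lt_top
    · have h1 := (h.next_collision hG h0T hT hfree').1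
      rw [Φ.flow_zero z hz, sub_zero] at h1
      rw [h1, ENNReal.ofReal_lt_ofReal_iff h0T]
      exact lt_of_not_ge fun hTτ => hfree T ⟨h0T, hTτ⟩ hT

end Orbit

end Literature.MathematicalPhysics.KineticTheory.KickMatchedHardSphereGas

end
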